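import Literature.Probability.LatticeModels.GHSInequality
import Literature.Probability.LatticeModels.TorusZeroMode
import Literature.Probability.LatticeModels.GaussianDomination
import Mathlib.Analysis.Calculus.Deriv.MeanValue
import HarnessLib

/-!
# The transport (extrapolation) inequality for the Ising magnetisation

Topic `Probability/LatticeModels`, namespace `Literature.Probability.LatticeModels`. Second file of
the decomposition of `spontaneousMagnetization_asymp_sqrt` (crit-ising.S13, Aizenman–Fernández
1986; first file `MagnetizationExponentUpper.lean`): the Ising form of the **extrapolation
principle** — the GHS inequality `∂M/∂β ≤ |J| M ∂M/∂h` (Aizenman–Barsky–Fernández 1987) bounds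
the slope of the level lines of the magnetisation in the `(β, h)` plane, so that the spontaneous
magnetisation at `β > β'` is dominated by the magnetisation at `β'` in the field
`|J| m*(β)(β - β')`. Printed (percolation rendering): G. Slade, *The lace expansion and its
applications*, LNM 1879 (2006), §9.3, proof of Thm. 9.10, (9.66)–(9.69):
`∂M̃/∂p ≤ 4|Ω| M̃ ∂M̃/∂h` ⇒ `0 ≤ -∂h/∂p|_{M̃ = m} ≤ 4|Ω| m` ⇒
`θ(p) = M(p, 0) ≤ M(p_c, 4|Ω| θ(p)(p - p_c))` (9.69), "an extrapolation principle [7, 9, 20, 73]"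
([9] = Aizenman–Fernández 1986, [73] = Fernández–Fröhlich–Sokal 1992 for the Ising model).

## What is proved (everything; no named fact is introduced)

* Part A (`affCpl`, `hasDerivAt_gksExpect_affCpl_cov`): in the spin-system framework `ν_{Λ;K}`
  of `GKSInequalities` (Friedli–Velenik 2017, §3.8.1), the derivative of `⟨F⟩` along an affine
  path `K + tW` of coupling constants is `∑ᵢ Wᵢ ⟨F; σ_{Cᵢ}⟩` (Glimm–Jaffe 1987, Prop. 4.2.1).
* Part B (`gksExpect_cov_bond_le`): GHS in the form `⟨σ_a; σ_xσ_y⟩ ≤ ⟨σ_y⟩⟨σ_a;σ_x⟩ +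
  ⟨σ_x⟩⟨σ_a;σ_y⟩` (from the tree theorem `gksExpect_ghs`, Lebowitz 1974).
* Part C (`le_of_deriv_ge_mul_sub`): if `f' ≥ χ (m - f)` with `χ ≥ 0` and `f(a) ≤ m`, then
  `f(a) ≤ f(b)` (mean value theorem).
* Part D (`isingCorr_torus_transport`): on the discrete torus `(ℤ/Lℤ)^d`, `L ≥ 3`, move along
  the straight path `t ↦ (β - t, field coupling β h₀ + 2d m t)`; by A, B, translation invariance
  (`isingExpect_plus_torus_translate`) and `2d`-regularity (`sum_edgeFinset_torusGraph`) the
  derivative of `⟨σ_0⟩_t` is `≥ 2d χ_t (m - ⟨σ_0⟩_t)`, `χ_t = ∑_x ⟨σ_0;σ_x⟩_t ≥ 0` (GKS II),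
  so by C, for any `m ≥ ⟨σ_0⟩_{𝕋;β,h₀}`: `⟨σ_0⟩_{𝕋;β,h₀} ≤ ⟨σ_0⟩_{𝕋;β',h'}`,
  `β' h' = β h₀ + 2d m (β - β')`.
* Part E (`freeCorr_le_plusCorr_transport`): free box ≤ torus ≤ plus box (GKS:
  `isingCorr_freeBox_le_torus`, `isingCorr_torus_le_plusBox`) and the box limits give, on `ℤ^d`,
  **`⟨σ_0⟩^∅_{β,h₀} ≤ ⟨σ_0⟩⁺_{β',h'}` with `β' h' = β h₀ + 2d ⟨σ_0⟩⁺_{β,h₀}(β - β')`**,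
  unconditionally; and (`spontaneousMagnetization_le_plusCorr_transport`) granting the named
  fact `freeCorr_eq_plusCorr_singleton_of_pos` of `MeanFieldLowerBound` (uniqueness of the
  one-point function at `h > 0`, Friedli–Velenik 2017, Thm. 3.25 (1)), letting `h₀ ↓ 0`:
  **`m*(β) ≤ ⟨σ_0⟩⁺_{β', 2d m*(β)(β-β')/β'}`** — for `β' = β_c` this is hypothesis `hE` of
  `spontaneousMagnetization_le_sqrt_of_isotherm` (`MagnetizationExponentUpper.lean`) with
  `K = 2d/β_c`.

## Why the torus, and where uniqueness enters

On the torus the one-point functions along the path are all equal, which makes the GHS bound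
self-referential (`f' ≥ 2dχ(m - f)`) and closes by Part C at the sharp slope `2d m`; a box with
`+` boundary condition has boundary magnetisations `≈ 1` and only gives slope `2d`. The price is
the identification of the torus magnetisation at `(β, h₀)`, `β > β_c`, from below: GKS gives
free box ≤ torus, hence the free state on the left of Part E; replacing it by `m*(β)` is exactly
uniqueness at `h₀ > 0` (`⟨σ_0⟩^∅_{β,h₀} = ⟨σ_0⟩⁺_{β,h₀} ≥ m*(β)`), kept as the explicit tree fact.

## Conventions

Tree parametrisation throughout: weight `exp(β ∑ σ_xσ_y + β h ∑ σ_x)`, so the physical field is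
`β h`; the straight path has constant physical-field slope `2d m` and the transported tree field
at `β'` is `h' = (β h₀ + 2d m (β - β'))/β'`. `0 < β'` is assumed where `h'` is formed.
-/

noncomputable section

open Finset Filter Topology
open scoped symmDiff

namespace Literature.Probability.LatticeModels

/-! ## Part A. Affine coupling paths in the GKS framework -/

section Affine

variable {Λ : Type*} [Fintype Λ] [DecidableEq Λ] {ι : Type*}
variable (s : Finset ι) (K W : ι → ℝ) (C : ι → Finset Λ)

/-- The affine coupling path `t ↦ K + t W` (all couplings moved at once, in the fixed
direction `W`). [folklore] -/
def affCpl (t : ℝ) : ι → ℝ := fun i => K i + t * W i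

omit [Fintype Λ] [DecidableEq Λ] in
/-- `affCpl K W 0 = K`. [folklore] -/
@[simp] theorem affCpl_zero : affCpl K W 0 = K := by
  funext i; simp [affCpl]

omit [Fintype Λ] [DecidableEq Λ] in
/-- The Hamiltonian is affine along the path: `H_{K + tW} = H_K + t H_W`. [folklore] -/
theorem gksHamiltonian_affCpl (t : ℝ) (ω : SpinConfig Λ) :
    gksHamiltonian s (affCpl K W t) C ω = gksHamiltonian s K C ω + t * gksHamiltonian s W C ω := by
  simp only [gksHamiltonian, affCpl, Finset.mul_sum, ← Finset.sum_add_distrib]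
  exact Finset.sum_congr rfl fun i _ => by ring

/-- `d/dt (Z_t ⟨F⟩_t) = Z_t ⟨F · H_W⟩_t` along the affine path (finite sums of exponentials;
Glimm–Jaffe 1987, proof of Prop. 4.2.1). [cite: GlimmJaffe1987, §4.2, Prop. 4.2.1] -/
theorem hasDerivAt_gksSum_affCpl (F : SpinConfig Λ → ℝ) (t : ℝ) :
    HasDerivAt (fun t => gksSum s (affCpl K W t) C F)
      (gksSum s (affCpl K W t) C (fun ω => F ω * gksHamiltonian s W C ω)) t := by
  have hfun : (fun t => gksSum s (affCpl K W t) C F) = fun t => ∑ ω, F ω *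
      Real.exp (gksHamiltonian s K C ω + t * gksHamiltonian s W C ω) := by
    funext t; simp only [gksSum, gksWeight, gksHamiltonian_affCpl]
  have hval : gksSum s (affCpl K W t) C (fun ω => F ω * gksHamiltonian s W C ω) =
      ∑ ω, F ω * (Real.exp (gksHamiltonian s K C ω + t * gksHamiltonian s W C ω) *
        gksHamiltonian s W C ω) := by
    simp only [gksSum, gksWeight, gksHamiltonian_affCpl]
    exact Finset.sum_congr rfl fun ω _ => by ring
  rw [hfun, hval]
  refine HasDerivAt.fun_sum fun ω _ => ?_
  have h1 : HasDerivAt (fun t : ℝ => gksHamiltonian s K C ω + t * gksHamiltonian s W C ω)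
      (gksHamiltonian s W C ω) t := by
    simpa using (hasDerivAt_mul_const (x := t) (gksHamiltonian s W C ω)).const_add
      (gksHamiltonian s K C ω)
  exact h1.exp.const_mul (F ω)

/-- `Z⟨F H_W⟩ = ∑ᵢ Wᵢ Z⟨F σ_{Cᵢ}⟩`. [folklore] -/
theorem gksSum_mul_gksHamiltonian (K' : ι → ℝ) (F : SpinConfig Λ → ℝ) :
    gksSum s K' C (fun ω => F ω * gksHamiltonian s W C ω) =
      ∑ i ∈ s, W i * gksSum s K' C (fun ω => F ω * spinProduct (C i) ω) := by
  simp only [gksSum, gksHamiltonian, Finset.mul_sum, Finset.sum_mul]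
  rw [Finset.sum_comm]
  exact Finset.sum_congr rfl fun i _ => Finset.sum_congr rfl fun ω _ => by ring

/-- The derivative of `⟨F⟩_{K + tW}` (quotient rule). [cite: GlimmJaffe1987, §4.2, Prop. 4.2.1] -/
theorem hasDerivAt_gksExpect_affCpl (F : SpinConfig Λ → ℝ) (t : ℝ) :
    HasDerivAt (fun t => gksExpect s (affCpl K W t) C F)
      ((gksSum s (affCpl K W t) C (fun ω => F ω * gksHamiltonian s W C ω) *
          gksSum s (affCpl K W t) C (fun _ => 1) -
        gksSum s (affCpl K W t) C F *
          gksSum s (affCpl K W t) C (fun ω => (1 : ℝ) * gksHamiltonian s W C ω)) /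
        gksSum s (affCpl K W t) C (fun _ => 1) ^ 2) t :=
  (hasDerivAt_gksSum_affCpl s K W C F t).div (hasDerivAt_gksSum_affCpl s K W C (fun _ => 1) t)
    (gksSum_one_pos _ _ _).ne'

/-- **The derivative of `⟨F⟩_{K + tW}` is a sum of covariances**:
`d/dt ⟨F⟩_t = ∑ᵢ Wᵢ (⟨F σ_{Cᵢ}⟩_t - ⟨F⟩_t ⟨σ_{Cᵢ}⟩_t)` (Glimm–Jaffe 1987, Prop. 4.2.1, for a
general direction `W` in the space of coupling constants). [cite: GlimmJaffe1987, §4.2, Prop. 4.2.1] -/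
theorem hasDerivAt_gksExpect_affCpl_cov (F : SpinConfig Λ → ℝ) (t : ℝ) :
    HasDerivAt (fun t => gksExpect s (affCpl K W t) C F)
      (∑ i ∈ s, W i * (gksExpect s (affCpl K W t) C (fun ω => F ω * spinProduct (C i) ω) -
        gksExpect s (affCpl K W t) C F * gksExpect s (affCpl K W t) C (spinProduct (C i)))) t := by
  have h := hasDerivAt_gksExpect_affCpl s K W C F t
  have hZ := gksSum_one_pos s (affCpl K W t) C
  set Z := gksSum s (affCpl K W t) C (fun _ => 1) with hZdef
  convert h using 1
  rw [gksSum_mul_gksHamiltonian s W C, gksSum_mul_gksHamiltonian s W C]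
  simp only [gksExpect, ← hZdef, one_mul]
  have hpt : ∀ i ∈ s, W i * (gksSum s (affCpl K W t) C (fun ω => F ω * spinProduct (C i) ω) / Z -
      gksSum s (affCpl K W t) C F / Z * (gksSum s (affCpl K W t) C (spinProduct (C i)) / Z)) =
      (W i * (gksSum s (affCpl K W t) C (fun ω => F ω * spinProduct (C i) ω) * Z) -
        gksSum s (affCpl K W t) C F * (W i * gksSum s (affCpl K W t) C (spinProduct (C i)))) / Z ^ 2 := by
    intro i _
    field_simp
  rw [Finset.sum_congr rfl hpt, ← Finset.sum_div]
  congr 1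
  rw [Finset.sum_mul, Finset.mul_sum, ← Finset.sum_sub_distrib]
  exact Finset.sum_congr rfl fun i _ => by ring

end Affine

/-! ## Part B. The GHS bound on the covariance with a bond -/

section GHSCov

variable {Λ : Type*} [Fintype Λ] [DecidableEq Λ] {ι : Type*}
variable (s : Finset ι) (K : ι → ℝ) (C : ι → Finset Λ)

/-- **GHS bound on the covariance of a spin with a bond**: for couplings `Kᵢ ≥ 0` on supports
of at most two sites, `⟨σ_a; σ_xσ_y⟩ ≤ ⟨σ_y⟩ ⟨σ_a; σ_x⟩ + ⟨σ_x⟩ ⟨σ_a; σ_y⟩`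
(`⟨f;g⟩ = ⟨fg⟩ - ⟨f⟩⟨g⟩`): this is `u₃(a,x,y) ≤ 0` (`gksExpect_ghs`) rearranged — the terms
`± ⟨σ_a⟩⟨σ_xσ_y⟩` cancel. It is the inequality behind `∂M/∂β ≤ |J| M ∂M/∂h`
(Aizenman–Barsky–Fernández 1987; Slade 2006, (9.26), for percolation). [cite: Lebowitz1974, eq. (1.8) (GHS)] [cite: Slade2006LaceExpansion, §9.2, eq. (9.26) (percolation analogue)] -/
theorem gksExpect_cov_bond_le (hK : ∀ i ∈ s, 0 ≤ K i) (hC : ∀ i ∈ s, (C i).card ≤ 2)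
    (a x y : Λ) :
    gksExpect s K C (fun σ => spinAt a σ * (spinAt x σ * spinAt y σ)) -
        gksExpect s K C (spinAt a) * gksExpect s K C (fun σ => spinAt x σ * spinAt y σ) ≤
      gksExpect s K C (spinAt y) *
          (gksExpect s K C (fun σ => spinAt a σ * spinAt x σ) -
            gksExpect s K C (spinAt a) * gksExpect s K C (spinAt x)) +
        gksExpect s K C (spinAt x) *
          (gksExpect s K C (fun σ => spinAt a σ * spinAt y σ) -
            gksExpect s K C (spinAt a) * gksExpect s K C (spinAt y)) := by
  have h := gksExpect_ghs s K C hK hC a x y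
  have h3 : gksExpect s K C (fun σ => spinAt a σ * (spinAt x σ * spinAt y σ)) =
      gksExpect s K C (fun σ => spinAt a σ * spinAt x σ * spinAt y σ) := by
    congr 1; funext σ; ring
  rw [h3]
  nlinarith [h]

end GHSCov

/-! ## Part C. A one-sided comparison lemma for `f' ≥ χ (m - f)` -/

/-- **No drop below the initial value**: if `f` is differentiable on `[a, b]` with
`f'(t) ≥ χ(t) (m - f(t))` for some `χ ≥ 0`, and `f(a) ≤ m`, then `f(a) ≤ f(b)`. (Where
`f < f(a) ≤ m` the derivative is nonnegative, so by the mean value theorem `f` cannot end below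
`f(a)`; this is the integration step of the extrapolation principle, Slade 2006, §9.3,
(9.67)–(9.69).) [cite: Slade2006LaceExpansion, §9.3, eqs. (9.67)–(9.69)] -/
theorem le_of_deriv_ge_mul_sub {f f' χ : ℝ → ℝ} {a b m : ℝ} (hab : a ≤ b)
    (hf : ∀ t ∈ Set.Icc a b, HasDerivAt f (f' t) t)
    (hineq : ∀ t ∈ Set.Icc a b, χ t * (m - f t) ≤ f' t) (hχ : ∀ t ∈ Set.Icc a b, 0 ≤ χ t)
    (hm : f a ≤ m) : f a ≤ f b := by
  by_contra hlt
  rw [not_le] at hlt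
  have hcont : ContinuousOn f (Set.Icc a b) := fun t ht => (hf t ht).continuousAt.continuousWithinAt
  -- the last time `t₀ ≤ b` with `f t₀ ≥ f a`
  set S : Set ℝ := {t ∈ Set.Icc a b | f a ≤ f t} with hS
  have haS : a ∈ S := ⟨⟨le_rfl, hab⟩, le_rfl⟩
  have hSbdd : BddAbove S := ⟨b, fun t ht => ht.1.2⟩
  have hSclosed : IsClosed S := by
    have : S = Set.Icc a b ∩ f ⁻¹' Set.Ici (f a) := by
      ext t; simp [hS, Set.mem_Ici]
    rw [this]
    exact hcont.preimage_isClosed_of_isClosed isClosed_Icc isClosed_Ici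
  set t₀ := sSup S with ht₀
  have ht₀S : t₀ ∈ S := hSclosed.csSup_mem ⟨a, haS⟩ hSbdd
  have ht₀b : t₀ < b := by
    rcases ht₀S.1.2.eq_or_lt with h | h
    · exact absurd (h ▸ ht₀S.2) (not_le.2 hlt)
    · exact h
  -- on `(t₀, b]`, `f < f a ≤ m`, hence `f' ≥ 0`; MVT on `[t₀, b]` contradicts `f b < f a ≤ f t₀`
  have hbelow : ∀ t ∈ Set.Ioc t₀ b, f t < f a := by
    intro t ht
    by_contra hge
    rw [not_lt] at hge
    have htS : t ∈ S := ⟨⟨ht₀S.1.1.trans ht.1.le, ht.2⟩, hge⟩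
    exact absurd (le_csSup hSbdd htS) (not_le.2 ht.1)
  have hsub : Set.Icc t₀ b ⊆ Set.Icc a b := Set.Icc_subset_Icc ht₀S.1.1 le_rfl
  obtain ⟨c, hc, hcder⟩ := exists_hasDerivAt_eq_slope f f' ht₀b
    (hcont.mono hsub) (fun t ht => hf t (hsub (Set.Ioo_subset_Icc_self ht)))
  have hc' : c ∈ Set.Icc a b := hsub (Set.Ioo_subset_Icc_self hc)
  have hfc : f c < f a := hbelow c ⟨hc.1, hc.2.le⟩
  have hpos : 0 ≤ f' c :=
    (mul_nonneg (hχ c hc') (by linarith [hm])).trans (hineq c hc')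
  have hslope : f' c < 0 := by
    rw [hcder]
    apply div_neg_of_neg_of_pos
    · linarith [ht₀S.2]
    · linarith
  linarith


/-! ## Part D. The transport inequality on the discrete torus -/

section Torus

variable {d L : ℕ} [NeZero L]

/-- A site of the torus as an element of the full volume `univ` (the finite-volume
configurations of the tree live on the subtype `↥Λ`). [folklore] -/
def tsite (x : TorusSite d L) : ↥(Finset.univ : Finset (TorusSite d L)) := ⟨x, Finset.mem_univ x⟩

/-- The direction of the transport path in the space of couplings of the torus model: `-1` on
every bond, `c` on every site (lower the inverse temperature at unit rate, raise the field at
rate `c`; Slade 2006, §9.3, the level-line geometry of Fig. 9.2). [cite: Slade2006LaceExpansion, §9.3, eqs. (9.66)–(9.69)] -/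
def torusDir (c : ℝ) : Sym2 (TorusSite d L) ⊕ TorusSite d L → ℝ
  | .inl e => -(if e ∈ edgesTouching (torusGraph d L) Finset.univ then 1 else 0)
  | .inr _ => c

/-- The couplings along the transport path started at `(β, h₀)`: bonds `β - t`, field
coupling `β h₀ + c t` (tree parametrisation: the field coupling is `β h`). [cite: Slade2006LaceExpansion, §9.3, eqs. (9.66)–(9.69)] -/
def torusCpl (β h₀ c t : ℝ) : Sym2 (TorusSite d L) ⊕ TorusSite d L → ℝ :=
  affCpl (gksCoupling (torusGraph d L) Finset.univ β h₀ .plus) (torusDir c) t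

/-- Unfolding equation of `torusCpl`. [folklore] -/
theorem torusCpl_def (β h₀ c t : ℝ) :
    torusCpl (d := d) (L := L) β h₀ c t =
      affCpl (gksCoupling (torusGraph d L) Finset.univ β h₀ .plus) (torusDir c) t := rfl

/-- The path couplings are the Ising couplings at inverse temperature `β - t` and tree field
`(β h₀ + c t)/(β - t)`. [folklore] -/
theorem torusCpl_eq {β h₀ c t : ℝ} (hβt : β - t ≠ 0) :
    torusCpl (d := d) (L := L) β h₀ c t =
      gksCoupling (torusGraph d L) Finset.univ (β - t) ((β * h₀ + c * t) / (β - t)) .plus := by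
  funext i
  rcases i with e | x
  · simp only [torusCpl, affCpl, torusDir, gksCoupling, interactionEdges_plus, edgeCoeff_plus,
      mul_one]
    split_ifs <;> ring
  · simp only [torusCpl, affCpl, torusDir, gksCoupling]
    field_simp

/-- At `t = 0` the path couplings are the Ising couplings at `(β, h₀)`. [folklore] -/
theorem torusCpl_zero (β h₀ c : ℝ) :
    torusCpl (d := d) (L := L) β h₀ c 0 = gksCoupling (torusGraph d L) Finset.univ β h₀ .plus := by
  rw [torusCpl, affCpl_zero]

/-- The path couplings are nonnegative for `t ≤ β`, `β, h₀, c, t ≥ 0`-compatible data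
(`β - t ≥ 0`, `β h₀ + c t ≥ 0`). [folklore] -/
theorem torusCpl_nonneg {β h₀ c t : ℝ} (hβt : t ≤ β) (hβ : 0 ≤ β) (hh₀ : 0 ≤ h₀) (hc : 0 ≤ c)
    (ht : 0 ≤ t) :
    ∀ i ∈ isingIdx (torusGraph d L) Finset.univ, 0 ≤ torusCpl (d := d) (L := L) β h₀ c t i := by
  rintro (e | x) -
  · simp only [torusCpl, affCpl, torusDir, gksCoupling, interactionEdges_plus, edgeCoeff_plus,
      mul_one]
    split_ifs <;> nlinarith
  · simp only [torusCpl, affCpl, torusDir, gksCoupling]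
    positivity

/-- The spin product attached to a site term is the spin at that site. [folklore] -/
theorem spinProduct_isingSupp_inr_univ (x : TorusSite d L) :
    spinProduct (isingSupp (Finset.univ : Finset (TorusSite d L)) (.inr x)) = spinAt (tsite x) := by
  funext τ
  rw [spinProduct_isingSupp_inr τ .plus (Finset.mem_univ x), spinAt_glue_of_mem]
  rfl

/-- The spin product attached to a bond term `{x, y}` is `σ_x σ_y`. [folklore] -/
theorem spinProduct_isingSupp_inl_univ {x y : TorusSite d L} (hxy : x ≠ y) :
    spinProduct (isingSupp (Finset.univ : Finset (TorusSite d L)) (.inl s(x, y))) =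
      fun τ => spinAt (tsite x) τ * spinAt (tsite y) τ := by
  funext τ
  rw [spinProduct_isingSupp_inl τ .plus hxy, if_pos (Finset.mem_univ x), if_pos (Finset.mem_univ y),
    spinAt_glue_of_mem, spinAt_glue_of_mem]
  rfl

/-- The torus one-point function `⟨σ_x⟩` at `(β, h)` in GKS form. [cite: FriedliVelenik2017, §3.8.1, p. 141] -/
theorem isingCorr_torus_singleton_eq_gksExpect (β h : ℝ) (x : TorusSite d L) :
    isingCorr (torusGraph d L) Finset.univ β h .plus {x} =
      gksExpect (isingIdx (torusGraph d L) Finset.univ)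
        (gksCoupling (torusGraph d L) Finset.univ β h .plus) (isingSupp Finset.univ)
        (spinAt (tsite x)) := by
  rw [isingCorr_eq_gksExpect (torusGraph d L) Finset.univ β h .plus (Finset.subset_univ {x})]
  have hset : inVol (Finset.univ : Finset (TorusSite d L)) {x} = {tsite x} := by
    ext z
    simp only [mem_inVol, Finset.mem_singleton, Subtype.ext_iff]
    rfl
  rw [hset, spinProduct_singleton]

/-- **Translation invariance of the torus one-point function**: `⟨σ_x⟩_{𝕋;β,h} = ⟨σ_0⟩_{𝕋;β,h}`. [cite: FriedliVelenik2017, Exercise 3.15 (solution, App. C)] -/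
theorem isingCorr_torus_singleton_eq_zero (β h : ℝ) (x : TorusSite d L) :
    isingCorr (torusGraph d L) Finset.univ β h .plus {x} =
      isingCorr (torusGraph d L) Finset.univ β h .plus {0} := by
  have h1 := isingExpect_plus_torus_translate (d := d) (L := L) Finset.univ β h x
  rw [Finset.map_univ_equiv] at h1
  rw [isingCorr, isingCorr, spinProduct_singleton, spinProduct_singleton]
  exact h1


/-- On the torus every edge touches the full volume: `ℰ^b_𝕋 = E(𝕋)`. [folklore] -/
theorem edgesTouching_univ_eq_edgeFinset :
    edgesTouching (torusGraph d L) (Finset.univ : Finset (TorusSite d L)) = (torusGraph d L).edgeFinset := by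
  ext e
  rw [mem_edgesTouching_iff, SimpleGraph.mem_edgeFinset]
  constructor
  · rintro ⟨he, -⟩; exact he
  · intro he
    refine ⟨he, ?_⟩
    induction e using Sym2.ind with
    | _ a b => exact ⟨a, Finset.mem_univ a, Sym2.mem_mk_left a b⟩

section Path

variable (β h₀ c : ℝ)

local notation "𝓘" => isingIdx (torusGraph d L) (Finset.univ : Finset (TorusSite d L))
local notation "𝓒" => isingSupp (Finset.univ : Finset (TorusSite d L))
local notation "E⟦" t ", " F "⟧" =>
  gksExpect (isingIdx (torusGraph d L) (Finset.univ : Finset (TorusSite d L)))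
    (torusCpl (d := d) (L := L) β h₀ c t) (isingSupp (Finset.univ : Finset (TorusSite d L))) F

/-- Along the path, the one-point function in GKS form is the torus one-point function at
`(β - t, (β h₀ + c t)/(β - t))` (for `t ≠ β`). [folklore] -/
theorem torusPath_spinAt_eq_isingCorr {t : ℝ} (hβt : β - t ≠ 0) (x : TorusSite d L) :
    E⟦t, spinAt (tsite x)⟧ =
      isingCorr (torusGraph d L) Finset.univ (β - t) ((β * h₀ + c * t) / (β - t)) .plus {x} := by
  rw [isingCorr_torus_singleton_eq_gksExpect, torusCpl_eq hβt]

/-- Translation invariance along the path: `⟨σ_x⟩_t = ⟨σ_0⟩_t`. [cite: FriedliVelenik2017, Exercise 3.15 (solution, App. C)] -/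
theorem torusPath_spinAt_eq_zero {t : ℝ} (hβt : β - t ≠ 0) (x : TorusSite d L) :
    E⟦t, spinAt (tsite x)⟧ = E⟦t, spinAt (tsite 0)⟧ := by
  rw [torusPath_spinAt_eq_isingCorr β h₀ c hβt, torusPath_spinAt_eq_isingCorr β h₀ c hβt,
    isingCorr_torus_singleton_eq_zero]

/-- **The derivative of the one-point function along the transport path**:
`d/dt ⟨σ_0⟩_t = -∑_{e} ⟨σ_0; σ_e⟩_t + c ∑_x ⟨σ_0; σ_x⟩_t` (bonds lowered at unit rate, field
raised at rate `c`; Glimm–Jaffe 1987, Prop. 4.2.1). [cite: GlimmJaffe1987, §4.2, Prop. 4.2.1] -/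
theorem hasDerivAt_torusPath (t : ℝ) :
    HasDerivAt (fun t => E⟦t, spinAt (tsite 0)⟧)
      (-(∑ e ∈ (torusGraph d L).edgeFinset,
          (E⟦t, fun τ => spinAt (tsite 0) τ * spinProduct (𝓒 (.inl e)) τ⟧ -
            E⟦t, spinAt (tsite 0)⟧ * E⟦t, spinProduct (𝓒 (.inl e))⟧)) +
        c * ∑ x : TorusSite d L,
          (E⟦t, fun τ => spinAt (tsite 0) τ * spinAt (tsite x) τ⟧ -
            E⟦t, spinAt (tsite 0)⟧ * E⟦t, spinAt (tsite x)⟧)) t := by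
  have h := hasDerivAt_gksExpect_affCpl_cov 𝓘
    (gksCoupling (torusGraph d L) Finset.univ β h₀ .plus) (torusDir (d := d) (L := L) c) 𝓒
    (spinAt (tsite 0)) t
  simp only [← torusCpl_def] at h
  convert h using 1
  rw [isingIdx, Finset.sum_disjSum, edgesTouching_univ_eq_edgeFinset]
  congr 1
  · rw [← Finset.sum_neg_distrib]
    refine Finset.sum_congr rfl fun e he => ?_
    have he' : e ∈ edgesTouching (torusGraph d L) Finset.univ := by
      rwa [edgesTouching_univ_eq_edgeFinset]
    simp only [torusDir, if_pos he']
    ring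
  · rw [Finset.mul_sum]
    refine Finset.sum_congr rfl fun x _ => ?_
    simp only [torusDir, spinProduct_isingSupp_inr_univ]

/-- **The GHS lower bound on the derivative**: for `0 ≤ t < β` with nonnegative path
couplings (and `L ≥ 3`), `d/dt ⟨σ_0⟩_t ≥ χ_t (c - 2d ⟨σ_0⟩_t)`, where
`χ_t = ∑_x ⟨σ_0; σ_x⟩_t ≥ 0`: each bond covariance is bounded by GHS
(`gksExpect_cov_bond_le`), the one-point functions are all equal to `⟨σ_0⟩_t` (translation
invariance), and every site has `2d` bonds (`sum_edgeFinset_torusGraph`). This is the torus form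
of `∂M/∂β ≤ |J| M ∂M/∂h` (Aizenman–Barsky–Fernández 1987; Slade 2006, (9.26)/(9.66)). [cite: Slade2006LaceExpansion, §9.3, eq. (9.66)] [cite: Lebowitz1974, eq. (1.8) (GHS)] -/
theorem deriv_torusPath_ge (hL : 3 ≤ L) {t : ℝ} (hβt : t < β) (hβ : 0 ≤ β) (hh₀ : 0 ≤ h₀)
    (hc : 0 ≤ c) (ht : 0 ≤ t) :
    (∑ x : TorusSite d L,
        (E⟦t, fun τ => spinAt (tsite 0) τ * spinAt (tsite x) τ⟧ -
          E⟦t, spinAt (tsite 0)⟧ * E⟦t, spinAt (tsite x)⟧)) *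
        (c - 2 * d * E⟦t, spinAt (tsite 0)⟧) ≤
      -(∑ e ∈ (torusGraph d L).edgeFinset,
          (E⟦t, fun τ => spinAt (tsite 0) τ * spinProduct (𝓒 (.inl e)) τ⟧ -
            E⟦t, spinAt (tsite 0)⟧ * E⟦t, spinProduct (𝓒 (.inl e))⟧)) +
        c * ∑ x : TorusSite d L,
          (E⟦t, fun τ => spinAt (tsite 0) τ * spinAt (tsite x) τ⟧ -
            E⟦t, spinAt (tsite 0)⟧ * E⟦t, spinAt (tsite x)⟧) := by
  have hL2 : 2 ≤ L := by omega
  have hβt' : β - t ≠ 0 := by linarith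
  have hK := torusCpl_nonneg (d := d) (L := L) hβt.le hβ hh₀ hc ht
  have hC : ∀ i ∈ 𝓘, (𝓒 i).card ≤ 2 := fun i _ => card_isingSupp_le_two _ i
  set M := E⟦t, spinAt (tsite 0)⟧ with hM
  set cov : TorusSite d L → ℝ := fun x =>
    E⟦t, fun τ => spinAt (tsite 0) τ * spinAt (tsite x) τ⟧ - M * E⟦t, spinAt (tsite x)⟧ with hcov
  -- every bond covariance is at most `M (cov x + cov y)`
  have hbond : ∀ (x : TorusSite d L) (i : Fin d),
      E⟦t, fun τ => spinAt (tsite 0) τ * spinProduct (𝓒 (.inl s(x, x + Pi.single i 1))) τ⟧ -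
          M * E⟦t, spinProduct (𝓒 (.inl s(x, x + Pi.single i 1)))⟧ ≤
        M * (cov x + cov (x + Pi.single i 1)) := by
    intro x i
    have hxy : x ≠ x + Pi.single i 1 := by
      intro h
      exact torus_single_ne_zero hL2 i (by simpa using h.symm)
    rw [spinProduct_isingSupp_inl_univ hxy]
    have hg := gksExpect_cov_bond_le 𝓘 (torusCpl (d := d) (L := L) β h₀ c t) 𝓒 hK hC
      (tsite 0) (tsite x) (tsite (x + Pi.single i 1))
    rw [torusPath_spinAt_eq_zero β h₀ c hβt' x,
      torusPath_spinAt_eq_zero β h₀ c hβt' (x + Pi.single i 1)] at hg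
    have e1 : cov x = E⟦t, fun τ => spinAt (tsite 0) τ * spinAt (tsite x) τ⟧ - M * M := by
      rw [hcov]; simp only; rw [torusPath_spinAt_eq_zero β h₀ c hβt' x]
    have e2 : cov (x + Pi.single i 1) =
        E⟦t, fun τ => spinAt (tsite 0) τ * spinAt (tsite (x + Pi.single i 1)) τ⟧ - M * M := by
      rw [hcov]; simp only; rw [torusPath_spinAt_eq_zero β h₀ c hβt' (x + Pi.single i 1)]
    rw [e1, e2]
    linarith
  -- sum over the bonds
  have hsum : ∑ e ∈ (torusGraph d L).edgeFinset,
      (E⟦t, fun τ => spinAt (tsite 0) τ * spinProduct (𝓒 (.inl e)) τ⟧ -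
        M * E⟦t, spinProduct (𝓒 (.inl e))⟧) ≤ M * (2 * d * ∑ x, cov x) := by
    rw [sum_edgeFinset_torusGraph hL]
    calc ∑ x : TorusSite d L, ∑ i : Fin d,
          (E⟦t, fun τ => spinAt (tsite 0) τ * spinProduct (𝓒 (.inl s(x, x + Pi.single i 1))) τ⟧ -
            M * E⟦t, spinProduct (𝓒 (.inl s(x, x + Pi.single i 1)))⟧)
        ≤ ∑ x : TorusSite d L, ∑ i : Fin d, M * (cov x + cov (x + Pi.single i 1)) :=
          Finset.sum_le_sum fun x _ => Finset.sum_le_sum fun i _ => hbond x i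
      _ = M * (∑ i : Fin d, (∑ x : TorusSite d L, cov x +
            ∑ x : TorusSite d L, cov (x + Pi.single i 1))) := by
          rw [Finset.sum_comm, Finset.mul_sum]
          refine Finset.sum_congr rfl fun i _ => ?_
          rw [← Finset.mul_sum, Finset.sum_add_distrib]
      _ = M * (2 * d * ∑ x, cov x) := by
          congr 1
          have hshift : ∀ i : Fin d, ∑ x : TorusSite d L, cov (x + Pi.single i 1) = ∑ x, cov x :=
            fun i => Equiv.sum_comp (Equiv.addRight (Pi.single i 1)) cov
          simp only [hshift, Finset.sum_const, Finset.card_univ, Fintype.card_fin, nsmul_eq_mul]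
          ring
  have hcovsum : ∑ x, cov x = ∑ x : TorusSite d L,
      (E⟦t, fun τ => spinAt (tsite 0) τ * spinAt (tsite x) τ⟧ - M * E⟦t, spinAt (tsite x)⟧) := rfl
  rw [← hcovsum]
  nlinarith [hsum]


/-- GKS II along the path: `⟨σ_0; σ_x⟩_t ≥ 0` for nonnegative path couplings. [cite: FriedliVelenik2017, Thm. 3.49, eq. (3.55), p. 141] -/
theorem torusPath_cov_nonneg {t : ℝ} (hβt : t ≤ β) (hβ : 0 ≤ β) (hh₀ : 0 ≤ h₀) (hc : 0 ≤ c)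
    (ht : 0 ≤ t) (x : TorusSite d L) :
    0 ≤ E⟦t, fun τ => spinAt (tsite 0) τ * spinAt (tsite x) τ⟧ -
      E⟦t, spinAt (tsite 0)⟧ * E⟦t, spinAt (tsite x)⟧ := by
  have hK := torusCpl_nonneg (d := d) (L := L) hβt hβ hh₀ hc ht
  have h := gksExpect_mul_gksExpect_le 𝓘 (torusCpl (d := d) (L := L) β h₀ c t) 𝓒 hK
    {tsite 0} {tsite x}
  rw [spinProduct_singleton, spinProduct_singleton, ← spinPair_eq_spinProduct_singleton_symmDiff] at h
  have hpair : (spinPair (tsite (d := d) (L := L) 0) (tsite x) : SpinConfig _ → ℝ) =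
      fun τ => spinAt (tsite 0) τ * spinAt (tsite x) τ := rfl
  rw [hpair] at h
  linarith

end Path

/-- **The transport inequality on the discrete torus** (Ising form of the extrapolation
principle, Slade 2006, §9.3, (9.66)–(9.69); Aizenman–Barsky–Fernández 1987 for the inequality
`∂M/∂β ≤ |J| M ∂M/∂h`). For the nearest-neighbour model on `(ℤ/Lℤ)^d`, `L ≥ 3`,
`0 < β' ≤ β`, tree field `h₀ ≥ 0`, and any `m ≥ 0` dominating the torus one-point function at
`(β, h₀)`: lowering the inverse temperature from `β` to `β'` while raising the field coupling
from `β h₀` to `β h₀ + 2d·m·(β - β')` does not decrease `⟨σ_0⟩`: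
`⟨σ_0⟩_{𝕋;β,h₀} ≤ ⟨σ_0⟩_{𝕋;β',h'}`, `β' h' = β h₀ + 2d m (β - β')`. Along the straight path
the derivative is `≥ 2d χ_t (m - ⟨σ_0⟩_t)` (`deriv_torusPath_ge`), so `⟨σ_0⟩_t` never drops
below its initial value (`le_of_deriv_ge_mul_sub`). [cite: Slade2006LaceExpansion, §9.3, eqs. (9.66)–(9.69)] [cite: AizenmanBarskyFernandezJSP1987, Thm. 1 (the inequality ∂M/∂β ≤ |J| M ∂M/∂h)] -/
theorem isingCorr_torus_transport (hL : 3 ≤ L) {β β' h₀ m : ℝ} (hβ' : 0 < β') (hββ' : β' ≤ β)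
    (hh₀ : 0 ≤ h₀) (hm0 : 0 ≤ m)
    (hm : isingCorr (torusGraph d L) Finset.univ β h₀ .plus {0} ≤ m) :
    isingCorr (torusGraph d L) Finset.univ β h₀ .plus {0} ≤
      isingCorr (torusGraph d L) Finset.univ β' ((β * h₀ + 2 * d * m * (β - β')) / β') .plus {0} := by
  set c : ℝ := 2 * d * m with hc
  have hc0 : 0 ≤ c := by positivity
  have hβ : 0 ≤ β := hβ'.le.trans hββ'
  set T : ℝ := β - β' with hT
  have hT0 : 0 ≤ T := by linarith
  -- the path one-point function and its endpoints
  set f : ℝ → ℝ := fun t => gksExpect (isingIdx (torusGraph d L) Finset.univ)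
    (torusCpl (d := d) (L := L) β h₀ c t) (isingSupp Finset.univ) (spinAt (tsite 0)) with hf
  have hf0 : f 0 = isingCorr (torusGraph d L) Finset.univ β h₀ .plus {0} := by
    have hβne : β ≠ 0 := by linarith
    have h := torusPath_spinAt_eq_isingCorr (d := d) (L := L) β h₀ c (t := 0) (by linarith) 0
    have e2 : (β * h₀ + c * 0) / (β - 0) = h₀ := by field_simp; ring
    rw [e2, sub_zero] at h
    exact h
  have hfT : f T = isingCorr (torusGraph d L) Finset.univ β'
      ((β * h₀ + 2 * d * m * (β - β')) / β') .plus {0} := by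
    have h := torusPath_spinAt_eq_isingCorr (d := d) (L := L) β h₀ c (t := T) (by linarith) 0
    have e1 : β - T = β' := by rw [hT]; ring
    have e2 : c * T = 2 * d * m * (β - β') := by rw [hc, hT]
    rw [e1, e2] at h
    exact h
  rw [← hf0, ← hfT]
  -- the comparison lemma
  refine le_of_deriv_ge_mul_sub (f := f) (m := m) hT0 (fun t ht => hasDerivAt_torusPath β h₀ c t)
    (χ := fun t => 2 * d * ∑ x : TorusSite d L,
      (gksExpect (isingIdx (torusGraph d L) Finset.univ) (torusCpl (d := d) (L := L) β h₀ c t)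
          (isingSupp Finset.univ) (fun τ => spinAt (tsite 0) τ * spinAt (tsite x) τ) -
        gksExpect (isingIdx (torusGraph d L) Finset.univ) (torusCpl (d := d) (L := L) β h₀ c t)
          (isingSupp Finset.univ) (spinAt (tsite 0)) *
        gksExpect (isingIdx (torusGraph d L) Finset.univ) (torusCpl (d := d) (L := L) β h₀ c t)
          (isingSupp Finset.univ) (spinAt (tsite x))))
    (fun t ht => ?_) (fun t ht => ?_) (by rw [hf0]; exact hm)
  · -- `χ (m - f) ≤ f'`
    have htβ : t < β := by have := ht.2; rw [hT] at this; linarith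
    have h := deriv_torusPath_ge (d := d) (L := L) β h₀ c hL htβ hβ hh₀ hc0 ht.1
    have e : c - 2 * d * f t = 2 * d * (m - f t) := by rw [hc]; ring
    rw [e] at h
    simp only [hf] at h ⊢
    refine le_trans (le_of_eq ?_) h
    ring
  · -- `0 ≤ χ`
    have htβ : t ≤ β := by have := ht.2; rw [hT] at this; linarith
    refine mul_nonneg (by positivity) (Finset.sum_nonneg fun x _ => ?_)
    exact torusPath_cov_nonneg β h₀ c htβ hβ hh₀ hc0 ht.1 x

end Torus

/-! ## Part E. Thermodynamic limits: from the torus to the free and plus states of `ℤ^d` -/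

section Limits

variable {d : ℕ}

/-- **The torus one-point function is at most the `+` one-point function of a box of `ℤ^d`**
(`2R + 3 < L`, `β, h ≥ 0`): shrink the volume inside the torus with `+` boundary condition
(`isingCorr_plus_le_of_subset`, GKS), then identify the `+` box of the torus with the `+` box of
`ℤ^d` (`isingExpect_plus_torusBox_eq`). [cite: FriedliVelenik2017, Exercise 3.12, p. 112, with §3.1, Def. 3.3] -/
theorem isingCorr_torus_le_plusBox {L R : ℕ} [NeZero L] (hRL : 2 * R + 3 < L) {β h : ℝ}
    (hβ : 0 ≤ β) (hh : 0 ≤ h) :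
    isingCorr (torusGraph d L) Finset.univ β h .plus {0} ≤
      isingCorr (zdGraph d) (box d R) β h .plus {0} := by
  have h1 : isingCorr (torusGraph d L) Finset.univ β h .plus {0} ≤
      isingCorr (torusGraph d L) ((box d R).image (Torus.proj L)) β h .plus {0} :=
    isingCorr_plus_le_of_subset (torusGraph d L) hβ hh
      (by
        rw [Finset.singleton_subset_iff, Finset.mem_image]
        exact ⟨0, zero_mem_box d R, torusProj_zero L⟩)
      (Finset.subset_univ _)
  have h2 : isingCorr (torusGraph d L) ((box d R).image (Torus.proj L)) β h .plus {0} =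
      isingCorr (zdGraph d) (box d R) β h .plus {0} := by
    rw [isingCorr, isingCorr, spinProduct_singleton, spinProduct_singleton]
    exact isingExpect_plus_torusBox_eq hRL β h
  exact h1.trans_eq h2

/-- **The free one-point function of a box of `ℤ^d` is at most the torus one-point function**
(`2M + 1 < L`, `β, h ≥ 0`; Griffiths' comparison, Friedli–Velenik 2017, Exercise 3.31 with
3.30): embed the free box isomorphically into the torus (`isingCorr_free_map`, twice) and
enlarge the volume (`isingCorr_free_le_of_subset`); on the whole torus the boundary condition is
immaterial (`isingExpect_univ_fixed`). The one-point analogue, with a field, of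
`isingTwoPoint_free_box_le_torus_of_gks`. [cite: FriedliVelenik2017, Exercise 3.31] -/
theorem isingCorr_freeBox_le_torus {L M : ℕ} [NeZero L] (hML : 2 * M + 1 < L) {β h : ℝ}
    (hβ : 0 ≤ β) (hh : 0 ≤ h) :
    isingCorr (zdGraph d) (box d M) β h .free {0} ≤
      isingCorr (torusGraph d L) Finset.univ β h .plus {0} := by
  classical
  set S := ↥(box d M) with hS
  let ι₁ : S ↪ Site d := Function.Embedding.subtype _
  let Gs : SimpleGraph S := (zdGraph d).comap ι₁
  have h0 : (0 : Site d) ∈ box d M := zero_mem_box d M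
  -- step 1: the free box on `ℤ^d` is the free model on `S`
  have hmap1 : (Finset.univ : Finset S).map ι₁ = box d M := by
    rw [Finset.univ_eq_attach, Finset.attach_map_val]
  have hA1 : ({⟨0, h0⟩} : Finset S).map ι₁ = {0} := by
    rw [Finset.map_singleton]; rfl
  have h1 : isingCorr (zdGraph d) (box d M) β h .free {0} =
      isingCorr Gs Finset.univ β h .free {⟨0, h0⟩} := by
    have := isingCorr_free_map (G := Gs) (G' := zdGraph d) ι₁ (Λ := Finset.univ)
      (fun a _ b _ => Iff.rfl) β h {⟨0, h0⟩}
    rw [hmap1, hA1] at this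
    exact this
  -- step 2: the free model on `S` is the free model on the image of the box in the torus
  let ι₂ : S ↪ TorusSite d L :=
    ⟨fun a => Torus.proj L a.1, fun a b hab =>
      Subtype.ext (torusProj_injOn_box (by omega) a.2 b.2 hab)⟩
  have hadj : ∀ a ∈ (Finset.univ : Finset S), ∀ b ∈ (Finset.univ : Finset S),
      ((torusGraph d L).Adj (ι₂ a) (ι₂ b) ↔ Gs.Adj a b) := fun a _ b _ =>
    torusGraph_adj_proj_iff hML a.2 b.2
  have hA2 : ({⟨0, h0⟩} : Finset S).map ι₂ = {0} := by
    rw [Finset.map_singleton]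
    change ({Torus.proj L 0} : Finset (TorusSite d L)) = {0}
    rw [torusProj_zero]
  have h2 : isingCorr Gs Finset.univ β h .free {⟨0, h0⟩} =
      isingCorr (torusGraph d L) (Finset.univ.map ι₂) β h .free {0} := by
    have := isingCorr_free_map (G := Gs) (G' := torusGraph d L) ι₂ hadj β h {⟨0, h0⟩}
    rw [hA2] at this
    exact this.symm
  -- step 3: enlarge the volume inside the torus; the b.c. on the whole torus is immaterial
  have h3 : isingCorr (torusGraph d L) (Finset.univ.map ι₂) β h .free {0} ≤
      isingCorr (torusGraph d L) Finset.univ β h .free {0} := by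
    refine isingCorr_free_le_of_subset (torusGraph d L) hβ hh ?_ (Finset.subset_univ _)
    rw [← hA2]
    exact Finset.map_subset_map.2 (Finset.subset_univ _)
  have h4 : isingCorr (torusGraph d L) Finset.univ β h .free {0} =
      isingCorr (torusGraph d L) Finset.univ β h .plus {0} := by
    rw [isingCorr, isingCorr, show (BoundaryCondition.plus : BoundaryCondition (TorusSite d L)) =
      .fixed 1 from rfl, isingExpect_univ_fixed]
  rw [h1, h2, ← h4]
  exact h3

/-- The transported field `h'(m) = (β h₀ + 2d m (β - β'))/β'` is nonnegative and monotone in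
`m` (for `0 < β' ≤ β`, `h₀, m ≥ 0`). [folklore] -/
theorem transportField_nonneg {β β' h₀ m : ℝ} (hβ' : 0 < β') (hββ' : β' ≤ β) (hh₀ : 0 ≤ h₀)
    (hm : 0 ≤ m) : 0 ≤ (β * h₀ + 2 * d * m * (β - β')) / β' := by
  have : 0 ≤ β := hβ'.le.trans hββ'
  have : 0 ≤ β - β' := by linarith
  positivity

/-- **Transport inequality in the thermodynamic limit** (Ising extrapolation principle, free
start / plus end): for the nearest-neighbour model on `ℤ^d`, `0 < β' ≤ β`, `h₀ ≥ 0`,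
`⟨σ_0⟩^∅_{β,h₀} ≤ ⟨σ_0⟩⁺_{β',h'}` with `β' h' = β h₀ + 2d ⟨σ_0⟩⁺_{β,h₀} (β - β')` (tree
fields). From the torus inequality `isingCorr_torus_transport` with
`m = ⟨σ_0⟩⁺_{Λ_{R₀};β,h₀}` (which dominates the torus one-point function,
`isingCorr_torus_le_plusBox`), the comparisons free box ≤ torus ≤ plus box
(`isingCorr_freeBox_le_torus`, `isingCorr_torus_le_plusBox`), the box limits of the free and plus
states, and the right-continuity of `h ↦ ⟨σ_0⟩⁺_{β',h}` as `R₀ → ∞`. No uniqueness of the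
infinite-volume state is used. (Slade 2006, §9.3, (9.69), is the percolation form
`θ(p) ≤ M(p_c, 4|Ω|θ(p)(p - p_c))`.) [cite: Slade2006LaceExpansion, §9.3, eqs. (9.66)–(9.69)] [cite: FriedliVelenik2017, Exercise 3.31 and Lemma 3.31 (1), p. 119] -/
theorem freeCorr_le_plusCorr_transport {β β' h₀ : ℝ} (hβ' : 0 < β') (hββ' : β' ≤ β)
    (hh₀ : 0 ≤ h₀) :
    freeCorr d β h₀ {0} ≤
      plusCorr d β' ((β * h₀ + 2 * d * plusCorr d β h₀ {0} * (β - β')) / β') {0} := by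
  have hβ : 0 ≤ β := hβ'.le.trans hββ'
  set M : ℝ := plusCorr d β h₀ {0} with hM
  have hM0 : 0 ≤ M := plusCorr_nonneg hβ hh₀ {0}
  -- the field map and the finite-volume majorants `m_{R₀} ≥ M`
  set hf : ℝ → ℝ := fun m => (β * h₀ + 2 * d * m * (β - β')) / β' with hhf
  set mR : ℕ → ℝ := fun R₀ => isingCorr (zdGraph d) (box d R₀) β h₀ .plus {0} with hmR
  have hmR_ge : ∀ R₀, M ≤ mR R₀ := fun R₀ =>
    plusCorr_le_isingCorr_plus_box hβ hh₀ (Finset.singleton_subset_iff.2 (zero_mem_box d R₀))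
  have hmR0 : ∀ R₀, 0 ≤ mR R₀ := fun R₀ => hM0.trans (hmR_ge R₀)
  have hf_nonneg : ∀ R₀, 0 ≤ hf (mR R₀) := fun R₀ => transportField_nonneg (d := d) hβ' hββ' hh₀ (hmR0 R₀)
  -- the key finite-volume chain
  have key : ∀ n R R₀ : ℕ, isingCorr (zdGraph d) (box d n) β h₀ .free {0} ≤
      isingCorr (zdGraph d) (box d R) β' (hf (mR R₀)) .plus {0} := by
    intro n R R₀
    set L : ℕ := 2 * (n + R + R₀) + 4 with hL
    haveI : NeZero L := ⟨by omega⟩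
    have hL3 : 3 ≤ L := by omega
    have h1 := isingCorr_freeBox_le_torus (d := d) (L := L) (M := n) (by omega) hβ hh₀
    have h2 : isingCorr (torusGraph d L) Finset.univ β h₀ .plus {0} ≤ mR R₀ :=
      isingCorr_torus_le_plusBox (d := d) (by omega) hβ hh₀
    have h3 := isingCorr_torus_transport (d := d) hL3 hβ' hββ' hh₀ (hmR0 R₀) h2
    have h4 := isingCorr_torus_le_plusBox (d := d) (L := L) (R := R) (by omega) hβ'.le (hf_nonneg R₀)
    exact h1.trans (h3.trans h4)
  -- `n → ∞`, then `R → ∞`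
  have step1 : ∀ R R₀ : ℕ, freeCorr d β h₀ {0} ≤
      isingCorr (zdGraph d) (box d R) β' (hf (mR R₀)) .plus {0} := fun R R₀ =>
    le_of_tendsto (hasBoxLimit_isingCorr_free_holds hβ hh₀ {0})
      (Eventually.of_forall fun n => key n R R₀)
  have step2 : ∀ R₀ : ℕ, freeCorr d β h₀ {0} ≤ plusCorr d β' (hf (mR R₀)) {0} := fun R₀ =>
    ge_of_tendsto (hasBoxLimit_isingCorr_plus_holds hβ'.le (hf_nonneg R₀) {0})
      (Eventually.of_forall fun R => step1 R R₀)
  -- `R₀ → ∞`: `m_{R₀} ↓ M`, right-continuity of the plus state in the field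
  have hmR_tendsto : Tendsto mR atTop (𝓝 M) := hasBoxLimit_isingCorr_plus_holds hβ hh₀ {0}
  have hhf_cont : Continuous hf := by
    simp only [hhf]
    fun_prop
  have hhf_mono : ∀ R₀, hf M ≤ hf (mR R₀) := by
    intro R₀
    simp only [hhf]
    refine div_le_div_of_nonneg_right ?_ hβ'.le
    have : 0 ≤ β - β' := by linarith
    have h2 : 2 * (d : ℝ) * M * (β - β') ≤ 2 * d * mR R₀ * (β - β') :=
      mul_le_mul_of_nonneg_right
        (mul_le_mul_of_nonneg_left (hmR_ge R₀) (by positivity : (0 : ℝ) ≤ 2 * d)) this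
    linarith
  have hfield_tendsto : Tendsto (fun R₀ => hf (mR R₀)) atTop (𝓝[Set.Ici (hf M)] (hf M)) :=
    tendsto_nhdsWithin_iff.2 ⟨(hhf_cont.tendsto M).comp hmR_tendsto,
      Eventually.of_forall fun R₀ => hhf_mono R₀⟩
  have hrc := plusCorr_continuousWithinAt_Ici_field (d := d) hβ'.le {0} (h₀ := hf M)
    (transportField_nonneg (d := d) hβ' hββ' hh₀ hM0)
  have hlim : Tendsto (fun R₀ => plusCorr d β' (hf (mR R₀)) {0}) atTop
      (𝓝 (plusCorr d β' (hf M) {0})) := hrc.tendsto.comp hfield_tendsto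
  exact ge_of_tendsto hlim (Eventually.of_forall step2)

/-- **The extrapolation inequality for the spontaneous magnetisation, given uniqueness at
`h > 0`**: granting `freeCorr_eq_plusCorr_singleton_of_pos` (`⟨σ_0⟩^∅_{β,h} = ⟨σ_0⟩⁺_{β,h}`
for `h > 0`, Friedli–Velenik 2017, Thm. 3.25 (1)), for `0 < β' ≤ β`,
`m*(β) ≤ ⟨σ_0⟩⁺_{β', 2d m*(β)(β - β')/β'}` — the Ising form of Slade's (9.69)
`θ(p) ≤ M(p_c, 4|Ω|θ(p)(p - p_c))`. Proof: `m*(β) ≤ ⟨σ_0⟩⁺_{β,h₀} = ⟨σ_0⟩^∅_{β,h₀}` for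
`h₀ > 0`, `freeCorr_le_plusCorr_transport`, and `h₀ ↓ 0` by right-continuity of the plus
state in the field at `0` and at the limit field. [cite: Slade2006LaceExpansion, §9.3, eq. (9.69)] [cite: FriedliVelenik2017, Thm. 3.25 (1), p. 116, and Lemma 3.31 (1), p. 119] -/
theorem spontaneousMagnetization_le_plusCorr_transport (hd : 1 ≤ d)
    (hU : freeCorr_eq_plusCorr_singleton_of_pos (d := d)) {β β' : ℝ} (hβ' : 0 < β')
    (hββ' : β' ≤ β) :
    spontaneousMagnetization d β ≤
      plusCorr d β' (2 * d * spontaneousMagnetization d β * (β - β') / β') {0} := by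
  have hβ : 0 ≤ β := hβ'.le.trans hββ'
  set ms : ℝ := spontaneousMagnetization d β with hms
  have hms0 : 0 ≤ ms := spontaneousMagnetization_nonneg_holds (d := d) hβ
  set hf : ℝ → ℝ → ℝ := fun h₀ m => (β * h₀ + 2 * d * m * (β - β')) / β' with hhf
  -- for every `h₀ > 0`
  have key : ∀ h₀ : ℝ, 0 < h₀ → ms ≤ plusCorr d β' (hf h₀ (plusCorr d β h₀ {0})) {0} := by
    intro h₀ hh₀
    calc ms = plusCorr d β 0 {0} := spontaneousMagnetization_eq_plusCorr β
      _ ≤ plusCorr d β h₀ {0} := plusCorr_mono_params hβ le_rfl le_rfl hh₀.le {0}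
      _ = freeCorr d β h₀ {0} := (hU hd hβ hh₀).symm
      _ ≤ plusCorr d β' (hf h₀ (plusCorr d β h₀ {0})) {0} :=
          freeCorr_le_plusCorr_transport hβ' hββ' hh₀.le
  -- `h₀ = 1/(k+1) ↓ 0`
  set u : ℕ → ℝ := fun k => 1 / ((k : ℝ) + 1) with hu
  have hu_pos : ∀ k, 0 < u k := fun k => by rw [hu]; positivity
  have hu_tendsto : Tendsto u atTop (𝓝[Set.Ici 0] 0) :=
    tendsto_nhdsWithin_iff.2 ⟨tendsto_one_div_add_atTop_nhds_zero_nat,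
      Eventually.of_forall fun k => (hu_pos k).le⟩
  -- `M(h₀) → m*`
  have hM_tendsto : Tendsto (fun k => plusCorr d β (u k) {0}) atTop (𝓝 ms) := by
    have hrc := plusCorr_continuousWithinAt_Ici_field (d := d) hβ {0} le_rfl
    rw [hms, spontaneousMagnetization_eq_plusCorr]
    exact hrc.tendsto.comp hu_tendsto
  -- the field tends to its limit from above
  have hf0 : hf 0 ms = 2 * d * ms * (β - β') / β' := by simp only [hhf]; ring
  have hfield_cont : Continuous fun p : ℝ × ℝ => hf p.1 p.2 := by
    simp only [hhf]
    fun_prop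
  have hfield_tendsto0 : Tendsto (fun k => hf (u k) (plusCorr d β (u k) {0})) atTop
      (𝓝 (hf 0 ms)) := by
    have hpair : Tendsto (fun k => (u k, plusCorr d β (u k) {0})) atTop (𝓝 (0, ms)) :=
      (tendsto_nhdsWithin_iff.1 hu_tendsto).1.prodMk_nhds hM_tendsto
    exact (hfield_cont.tendsto (0, ms)).comp hpair
  have hfield_ge : ∀ k, hf 0 ms ≤ hf (u k) (plusCorr d β (u k) {0}) := by
    intro k
    simp only [hhf]
    refine div_le_div_of_nonneg_right ?_ hβ'.le
    have h1 : ms ≤ plusCorr d β (u k) {0} := by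
      rw [hms, spontaneousMagnetization_eq_plusCorr]
      exact plusCorr_mono_params hβ le_rfl le_rfl (hu_pos k).le {0}
    have : 0 ≤ β - β' := by linarith
    have h2 : 2 * (d : ℝ) * ms * (β - β') ≤ 2 * d * plusCorr d β (u k) {0} * (β - β') :=
      mul_le_mul_of_nonneg_right
        (mul_le_mul_of_nonneg_left h1 (by positivity : (0 : ℝ) ≤ 2 * d)) this
    have h3 : β * 0 ≤ β * u k := mul_le_mul_of_nonneg_left (hu_pos k).le hβ
    linarith
  have hfield_tendsto : Tendsto (fun k => hf (u k) (plusCorr d β (u k) {0})) atTop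
      (𝓝[Set.Ici (hf 0 ms)] (hf 0 ms)) :=
    tendsto_nhdsWithin_iff.2 ⟨hfield_tendsto0, Eventually.of_forall hfield_ge⟩
  have hf0_nonneg : 0 ≤ hf 0 ms := by
    rw [hf0]
    have : 0 ≤ β - β' := by linarith
    positivity
  have hrc' := plusCorr_continuousWithinAt_Ici_field (d := d) hβ'.le {0} hf0_nonneg
  have hlim : Tendsto (fun k => plusCorr d β' (hf (u k) (plusCorr d β (u k) {0})) {0}) atTop
      (𝓝 (plusCorr d β' (hf 0 ms) {0})) := hrc'.tendsto.comp hfield_tendsto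
  rw [← hf0]
  exact ge_of_tendsto hlim (Eventually.of_forall fun k => key (u k) (hu_pos k))

end Limits

end Literature.Probability.LatticeModels
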